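import Summits.HodgeConjecture.HodgeConjecture.Theorems.Ring2SemiregularRepresentativesVHC
import Literature.Barriers.HodgeConjecture.ExceptionalHodgeClasses
import HarnessLib

/-!
# Ring 2 — road b02 (D-0059): the RE-TYPED crux K-SR♭ / K-SR♭∃ over the landed carrier (Bloch's Remark (7.5) literally)

research route conditional on HC_CM; not a corollary; Q11.4-sentence-2 already refuted in dim ≥ 3.

Mathematics and Lean text: cell `vhodge`, seat P4 g7, memo `run/shared/lean/pub/vhodge/memos/ROUTE-P4-g7-KSRflat.lean`
(sha256/16 a8d0c37cba0b05bb; memo ROUTE-P4-g7.md 3fc071ca0bde0b18), re-homed to the carrier's namespace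
`Ring2.SemiregularRepresentatives` (`Theorems/Ring2SemiregularRepresentativesVHC.lean`, p406571) by ring2 LEAD gen 145 on
director-hodge's ruling «2026-08-25T20:41:20Z» (2)–(3): declarations and proofs VERBATIM; only the `namespace … end` pair, this
header and two one-line docstrings differ. Nothing is asserted: every `@[conjecture] def` is a HYPOTHESIS wherever used; `HC_CM`
occurs nowhere; K-SR♭, K-SR♭∃, K-C, `HC_AV`, `AbelianSchemeVHC`, `HodgeConjecture` are NOT claimed.
CONTENT (decl docstrings carry the detail): §1 K-SR♭ `AdmissibleRepresentativesLef` = the carrier's `AdmissibleRepresentatives 𝒪`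
with ONE clause strengthened — the correction `Z` is on EVERY fibre a LEFSCHETZ class (`divisorClassesSpan`, van Geemen §2.4) and
algebraic; §2 it feeds the landed chain; §3 Lefschetz carriers (null sheaf, line bundles, semi-homogeneous bundles) witness it only
where `W` is Lefschetz — the content is the EXCEPTIONAL part of `W`; §4 the RECOMMENDED typing K-SR♭∃
`SemiregularSheafRepresentativesLefAt` (carrier at SOME fibre) with its sorry-free chain via ring 2's node (U) to `HC_AV`
(`hc_av_of_semiregularSheafRepresentativesLefAt`); §5 director-hodge's check (a) in the kernel (`nullDatum_fails_of_exceptional`,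
`weilFourfold_defeats_lefschetzCarriers`).
-/

noncomputable section

open CategoryTheory CategoryTheory.Limits AlgebraicGeometry Topology

namespace Summit.HodgeConjecture.HodgeConjecture.Ring2.SemiregularRepresentatives

set_option linter.dupNamespace false

open Literature.AlgebraicGeometry Literature.AlgebraicGeometry.Motives
open Literature.AlgebraicGeometry.HodgeTheory
open Literature.AlgebraicTopology.SingularHomology
open Literature.Barriers.HodgeConjecture (divisorClassesSpan divisorMonomials Weil1977_exceptionalHodgeClasses)
open Literature.AlgebraicGeometry.Andre1996 (andre1996_cmAnchoredPencil
  andre1996_cmHodgeClasses_algebraicallyAnchoredPencils)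
open Summit.HodgeConjecture.HodgeConjecture.Ring2.Hypotheses (AbelianSchemeVHC)
open Summit.HodgeConjecture.HodgeConjecture.Ring2.Binders
open Summit.HodgeConjecture.HodgeConjecture.Ring2.SemiregularRepresentatives
open Summit.Ventures.HSemireg (ObjClass LocalVariationalHodgeFor bfSheafClass
  localVariationalHodgeFor_bfSheafClass)

/-! ## §1 K-SR♭: admissible representatives with a fibrewise-LEFSCHETZ correction -/

/-- **`AdmissibleRepresentativesLef 𝒪` — road b02's missing input for the door `𝒪`, Bloch's form (7.5)
literally** (crux; OPEN; a HYPOTHESIS wherever used). Binders = those of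
`Ring2.SemiregularRepresentatives.AdmissibleRepresentatives` / `Ring2.Binders.OneParameterAbelianSchemeVHCGerm`
verbatim. Conclusion: a finite set of degrees `I ∋ p`, classes `κ` on `𝒳_{s₀}` admissible for `𝒪`, global
classes `V_q` fibrewise of type `(q,q)` restricting to `κ_q` at `s₀` (`q ∈ I`), a scalar `a ≠ 0` and a global
class `Z` which is FIBREWISE A LEFSCHETZ CLASS — `Z|_{𝒳_s} ∈ Dᵖ(𝒳_s) ⊗ ℂ`, the span of `p`-fold cup products
of rational `(1,1)`-classes (and fibrewise algebraic, redundant on abelian fibres) — with `V_p = a·W + Z`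
("`a·z₀ + b·l₀ᵖ`", `l₀` a polarisation). WHY IT MIGHT FAIL: `I`-semiregularity makes `Ext²(ℰ₀,ℰ₀)` inject into
`⊕_{q ∈ I} H^{q+1}(Ω^{q-1})` while `ch_p(ℰ₀)` must be EXCEPTIONAL modulo `Dᵖ`; every sheaf of record at a
Weil fibre fails one or the other (hsemireg NEG #1–#16; semi-homogeneous bundles have `ch ∈ ℚ[divisors]`).
[cite: Bloch1972Semiregularity, Remark (7.5) and Thm. (7.4)] [cite: BuchweitzFlenner2003, §5 Thm. 5.1]
[cite: vanGeemen1994HodgeAV, §2.4 and Thm. 4.11] [cite: Grothendieck1966, footnote 13] -/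
@[conjecture] def AdmissibleRepresentativesLef (𝒪 : ObjClass) : Prop :=
  ∀ ⦃n : ℕ⦄ ⦃𝒳 S : SchemeOver ℂ⦄ (f : 𝒳 ⟶ S), IsSmoothProjectiveFamily f n → IsQuasiProjectiveOver 𝒳 →
    IrreducibleSpace S.left → IsAffine S.left → AlgebraicGeometry.Smooth S.hom → topologicalKrullDim S.left = 1 →
    (∀ s : ComplexPoints S, ∃ A' : AbelianVariety ℂ, A'.dim = n ∧ Nonempty (A'.X ≅ fiberOver f s)) →
    (∃ e : S ⟶ 𝒳, e ≫ f = 𝟙 S) →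
    ∀ (p : ℕ) (W : complexBetti 𝒳 (2 * p)),
      (∀ s : ComplexPoints S, IsRationalClass (complexBetti.map (fiberι f s) (2 * p) W) ∧
        IsOfHodgeType n (fiberOver f s) (2 * p) p p (complexBetti.map (fiberι f s) (2 * p) W)) →
      ∀ s₀ : ComplexPoints S,
        complexBetti.map (fiberι f s₀) (2 * p) W ∈ algebraicClasses (fiberOver f s₀) p →
        ∃ (I : Finset ℕ) (κ : (q : ℕ) → complexBetti (fiberOver f s₀) (2 * q))
          (V : (q : ℕ) → complexBetti 𝒳 (2 * q)) (a : ℂ) (Z : complexBetti 𝒳 (2 * p)),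
          p ∈ I ∧ 𝒪 n (fiberOver f s₀) I κ ∧ a ≠ 0 ∧
          (∀ s : ComplexPoints S,
            complexBetti.map (fiberι f s) (2 * p) Z ∈ algebraicClasses (fiberOver f s) p ∧
            complexBetti.map (fiberι f s) (2 * p) Z ∈ divisorClassesSpan (fiberOver f s) n p) ∧
          V p = a • W + Z ∧
          (∀ q ∈ I, κ q = complexBetti.map (fiberι f s₀) (2 * q) (V q)) ∧
          (∀ q ∈ I, ∀ s : ComplexPoints S,
            IsOfHodgeType n (fiberOver f s) (2 * q) q q (complexBetti.map (fiberι f s) (2 * q) (V q)))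

/-- **K-SR♭ `SemiregularSheafRepresentativesLef`** — the sheaf-door instance (crux, rank 2, of the repaired b02
brief): for every Chern character theory `C`, admissible representatives of class `bfSheafClass C` with a
fibrewise-Lefschetz correction. [cite: BuchweitzFlenner2003, §5 Thm. 5.1 and Def. 4.10]
[cite: Bloch1972Semiregularity, Remark (7.5)] -/
@[conjecture] def SemiregularSheafRepresentativesLef : Prop :=
  ∀ C : ChernCharacterBetti, AdmissibleRepresentativesLef (bfSheafClass C)

/-! ## §2 K-SR♭ feeds the landed chain (drop the Lefschetz conjunct) -/

/-- **K-SR♭ ⟹ K-SR** for every door: forget that `Z` is fibrewise Lefschetz. [folklore] -/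
theorem AdmissibleRepresentativesLef.toAdmissibleRepresentatives {𝒪 : ObjClass}
    (h : AdmissibleRepresentativesLef 𝒪) : AdmissibleRepresentatives 𝒪 := by
  intro n 𝒳 S f hf h𝒳 hirr haff hsm hdim habel he p W hW s₀ hs₀
  obtain ⟨I, κ, V, a, Z, hpI, hκ, ha, hZ, hVp, hκV, hVH⟩ := h f hf h𝒳 hirr haff hsm hdim habel he p W hW s₀ hs₀
  exact ⟨I, κ, V, a, Z, hpI, hκ, ha, fun s => (hZ s).1, hVp, hκV, hVH⟩

/-- Monotonicity of K-SR♭ in the door. [folklore] -/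
theorem AdmissibleRepresentativesLef.mono {𝒪 𝒪' : ObjClass} (h𝒪 : ∀ n X₀ I κ, 𝒪 n X₀ I κ → 𝒪' n X₀ I κ)
    (h : AdmissibleRepresentativesLef 𝒪) : AdmissibleRepresentativesLef 𝒪' := by
  intro n 𝒳 S f hf h𝒳 hirr haff hsm hdim habel he p W hW s₀ hs₀
  obtain ⟨I, κ, V, a, Z, hpI, hκ, ha, hZ, hVp, hκV, hVH⟩ := h f hf h𝒳 hirr haff hsm hdim habel he p W hW s₀ hs₀
  exact ⟨I, κ, V, a, Z, hpI, h𝒪 _ _ _ _ hκ, ha, hZ, hVp, hκV, hVH⟩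

/-- K-SR♭ ⟹ K-SR (the landed v2.1 crux): drop the Lefschetz conjunct, door by door. [folklore] -/
theorem semiregularSheafRepresentatives_of_lef (h : SemiregularSheafRepresentativesLef) :
    SemiregularSheafRepresentatives :=
  fun C => (h C).toAdmissibleRepresentatives

/-- **The repaired `closes`-shape**: `K-C → K-SR♭ → BF Thm. 5.1 → curve residual → André #21 → André #22 → HC_AV`
(the landed `hc_av_of_semiregularSheafRepresentatives` after §2). [cite: BuchweitzFlenner2003, §5 Thm. 5.1]
[cite: Andre1996Motifs, §6.3 Lemmes 6.3.1–6.3.3] -/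
theorem hc_av_of_semiregularSheafRepresentativesLef (hC : ChernCharacterOnBetti)
    (hSR : SemiregularSheafRepresentativesLef)
    (hBF : BuchweitzFlenner2003_variationalHodge_ISemiregular_model)
    (hqp : OneParameterAbelianSchemeQuasiProjective) (h₂₁ : andre1996_cmAnchoredPencil)
    (h₂₂ : andre1996_cmHodgeClasses_algebraicallyAnchoredPencils) :
    Theses.PadicSemiregularLift.HodgeAbelianVarieties :=
  hc_av_of_semiregularSheafRepresentatives hC (semiregularSheafRepresentatives_of_lef hSR) hBF hqp h₂₁ h₂₂

/-- The same onto row b02. [cite: BuchweitzFlenner2003, §5 Thm. 5.1] -/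
theorem abelianSchemeVHC_of_semiregularSheafRepresentativesLef (hC : ChernCharacterOnBetti)
    (hSR : SemiregularSheafRepresentativesLef)
    (hBF : BuchweitzFlenner2003_variationalHodge_ISemiregular_model)
    (hqp : OneParameterAbelianSchemeQuasiProjective) : AbelianSchemeVHC :=
  abelianSchemeVHC_of_semiregularSheafRepresentatives hC (semiregularSheafRepresentatives_of_lef hSR) hBF hqp

/-- For an arbitrary door: K-SR♭ + the door's local variational statement ⟹ HC_AV modulo the same print. -/
theorem hc_av_of_lef {𝒪 : ObjClass} (hT : LocalVariationalHodgeFor 𝒪) (hSR : AdmissibleRepresentativesLef 𝒪)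
    (hqp : OneParameterAbelianSchemeQuasiProjective) (h₂₁ : andre1996_cmAnchoredPencil)
    (h₂₂ : andre1996_cmHodgeClasses_algebraicallyAnchoredPencils) :
    Theses.PadicSemiregularLift.HodgeAbelianVarieties :=
  hc_av_of hT hSR.toAdmissibleRepresentatives hqp h₂₁ h₂₂

/-! ## §3 Where K-SR♭ has content: Lefschetz carriers force a Lefschetz class -/

/-- **A Lefschetz carrier forces `W|_{𝒳_{s₀}}` Lefschetz.** In the data of K-SR♭ at `s₀`: if the admissible
class `κ_p` itself lies in `Dᵖ(𝒳_{s₀}) ⊗ ℂ` (the NULL carrier `κ = 0`; a line bundle or a semi-homogeneous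
bundle, whose Chern character is a polynomial in divisor classes), then so does `W|_{𝒳_{s₀}}`
(`W|_{s₀} = a⁻¹ · (κ_p − Z|_{s₀})`). Contrapositive: at a fibre where `W` is EXCEPTIONAL
(`Weil1977_exceptionalHodgeClasses`), K-SR♭ demands a carrier with exceptional `ch_p` — the null witness
of the vacuity certificate is gone. [cite: vanGeemen1994HodgeAV, §2.4 and Thm. 4.11] -/
theorem lefschetz_of_lefschetzCarrier {n p : ℕ} {𝒳 S : SchemeOver ℂ} (f : 𝒳 ⟶ S) (s₀ : ComplexPoints S)
    (W Z Vp : complexBetti 𝒳 (2 * p)) (κp : complexBetti (fiberOver f s₀) (2 * p)) (a : ℂ) (ha : a ≠ 0)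
    (hVp : Vp = a • W + Z) (hκ : κp = complexBetti.map (fiberι f s₀) (2 * p) Vp)
    (hZ : complexBetti.map (fiberι f s₀) (2 * p) Z ∈ divisorClassesSpan (fiberOver f s₀) n p)
    (hκL : κp ∈ divisorClassesSpan (fiberOver f s₀) n p) :
    complexBetti.map (fiberι f s₀) (2 * p) W ∈ divisorClassesSpan (fiberOver f s₀) n p := by
  have hW : complexBetti.map (fiberι f s₀) (2 * p) W =
      a⁻¹ • (κp - complexBetti.map (fiberι f s₀) (2 * p) Z) := by
    rw [hκ, hVp, map_add, map_smul, add_sub_cancel_right, smul_smul, inv_mul_cancel₀ ha, one_smul]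
  rw [hW]
  exact Submodule.smul_mem _ _ (Submodule.sub_mem _ hκL hZ)

/-- **The null datum no longer witnesses the crux**: with `κ = 0` (empty sheaf) the K-SR♭ data at `s₀` force
`W|_{𝒳_{s₀}} ∈ Dᵖ ⊗ ℂ`. [cite: vanGeemen1994HodgeAV, §2.4] -/
theorem nullCarrier_forces_lefschetz {n p : ℕ} {𝒳 S : SchemeOver ℂ} (f : 𝒳 ⟶ S) (s₀ : ComplexPoints S)
    (W Z Vp : complexBetti 𝒳 (2 * p)) (a : ℂ) (ha : a ≠ 0) (hVp : Vp = a • W + Z)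
    (hκ : (0 : complexBetti (fiberOver f s₀) (2 * p)) = complexBetti.map (fiberι f s₀) (2 * p) Vp)
    (hZ : complexBetti.map (fiberι f s₀) (2 * p) Z ∈ divisorClassesSpan (fiberOver f s₀) n p) :
    complexBetti.map (fiberι f s₀) (2 * p) W ∈ divisorClassesSpan (fiberOver f s₀) n p :=
  lefschetz_of_lefschetzCarrier f s₀ W Z Vp 0 a ha hVp hκ hZ (Submodule.zero_mem _)

/-- **Conversely, where `W` is fibrewise Lefschetz the crux is free** (those classes are algebraic by Lefschetz
`(1,1)` anyway): if `W|_{𝒳_s} ∈ Dᵖ ⊗ ℂ` and is algebraic for every `s`, the null datum of a door with null data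
witnesses K-SR♭ for this `W` — recorded to say precisely that K-SR♭'s content is the EXCEPTIONAL part of `W`.
[cite: vanGeemen1994HodgeAV, §2.4] -/
theorem admissibleRepresentativesLef_pointwise_of_lefschetz {𝒪 : ObjClass}
    (h𝒪 : ∀ (n : ℕ) (X₀ : SchemeOver ℂ) (p : ℕ), 𝒪 n X₀ {p} (fun _ => 0))
    {n p : ℕ} {𝒳 S : SchemeOver ℂ} (f : 𝒳 ⟶ S) (W : complexBetti 𝒳 (2 * p))
    (hW : ∀ s : ComplexPoints S, IsRationalClass (complexBetti.map (fiberι f s) (2 * p) W) ∧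
        IsOfHodgeType n (fiberOver f s) (2 * p) p p (complexBetti.map (fiberι f s) (2 * p) W))
    (hWL : ∀ s : ComplexPoints S,
      complexBetti.map (fiberι f s) (2 * p) W ∈ algebraicClasses (fiberOver f s) p ∧
      complexBetti.map (fiberι f s) (2 * p) W ∈ divisorClassesSpan (fiberOver f s) n p)
    (s₀ : ComplexPoints S) :
    ∃ (I : Finset ℕ) (κ : (q : ℕ) → complexBetti (fiberOver f s₀) (2 * q))
      (V : (q : ℕ) → complexBetti 𝒳 (2 * q)) (a : ℂ) (Z : complexBetti 𝒳 (2 * p)),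
      p ∈ I ∧ 𝒪 n (fiberOver f s₀) I κ ∧ a ≠ 0 ∧
      (∀ s : ComplexPoints S,
        complexBetti.map (fiberι f s) (2 * p) Z ∈ algebraicClasses (fiberOver f s) p ∧
        complexBetti.map (fiberι f s) (2 * p) Z ∈ divisorClassesSpan (fiberOver f s) n p) ∧
      V p = a • W + Z ∧
      (∀ q ∈ I, κ q = complexBetti.map (fiberι f s₀) (2 * q) (V q)) ∧
      (∀ q ∈ I, ∀ s : ComplexPoints S,
        IsOfHodgeType n (fiberOver f s) (2 * q) q q (complexBetti.map (fiberι f s) (2 * q) (V q))) := by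
  refine ⟨{p}, fun _ => 0, fun _ => 0, 1, -W, Finset.mem_singleton_self p, h𝒪 n _ p, one_ne_zero,
    fun s => ⟨?_, ?_⟩, ?_, fun q _ => ?_, fun q _ s => ?_⟩
  · rw [map_neg]; exact Submodule.neg_mem _ (hWL s).1
  · rw [map_neg]; exact Submodule.neg_mem _ (hWL s).2
  · rw [one_smul, add_neg_cancel]
  · rw [map_zero]
  · obtain ⟨A, -⟩ := (hW s).2
    rw [map_zero]
    exact IsOfHodgeType.zero A _ _ _

/-! ## §4 The RECOMMENDED typing K-SR♭∃: the carrier at SOME fibre of the pencil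

The road needs the admissible carrier at ONE well-chosen fibre per pencil (André's anchor), not at every fibre
where `W` happens to be algebraic (at a generic Weil fibre — `W` algebraic there by Schoen/Markman, NS rank 1 —
K-SR♭ demands an `I`-semiregular `ℰ₀` with EXCEPTIONAL `ch_p`, against which all evidence of record speaks:
hsemireg NEG #1–#16, vhodge COR R). K-SR♭∃ asks for a fibre `s₁` and a carrier there; it feeds ring 2's node (U)
`OneParameterAbelianSchemeVHCUncountable` (the door makes `W` algebraic on an open set around `s₁`, which is
uncountable on a curve), hence row b02 and `HC_AV` by ring 2's exactness, with NO new residual. -/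

/-- **`AdmissibleRepresentativesLefAt 𝒪` (K-SR♭∃ for the door `𝒪`)** — binders of `AdmissibleRepresentatives`
verbatim; conclusion: SOME complex point `s₁` of the base and, on `𝒳_{s₁}`, the data of K-SR♭ (`I ∋ p`, `κ`
admissible for `𝒪`, fibrewise-Hodge global `V_q` restricting to `κ_q` at `s₁`, `a ≠ 0`, a fibrewise LEFSCHETZ (and
algebraic) global correction `Z`, `V_p = a·W + Z`). OPEN; a HYPOTHESIS wherever used. WHY IT MIGHT FAIL: on a
generic-NS-rank-1 pencil flatness pins `Z ≡ c·Θᵖ` on fibres, so at the chosen fibre `ch_p(ℰ₀) = a·W|_{s₁} + c·θᵖ`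
EXACTLY with `ℰ₀` `I`-semiregular — at a split CM anchor `𝒳_{s₁} ≃ Eⁿ` this is a sum-of-line-bundles design
problem of the kind hsemireg's censuses found empty (0/218 at `g = 4`). [cite: Bloch1972Semiregularity, Remark (7.5)]
[cite: BuchweitzFlenner2003, §5 Thm. 5.1] [cite: vanGeemen1994HodgeAV, §2.4 and Thm. 4.11]
[cite: Andre1996Motifs, §6.3 Lemme 6.3.1] -/
@[conjecture] def AdmissibleRepresentativesLefAt (𝒪 : ObjClass) : Prop :=
  ∀ ⦃n : ℕ⦄ ⦃𝒳 S : SchemeOver ℂ⦄ (f : 𝒳 ⟶ S), IsSmoothProjectiveFamily f n → IsQuasiProjectiveOver 𝒳 →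
    IrreducibleSpace S.left → IsAffine S.left → AlgebraicGeometry.Smooth S.hom → topologicalKrullDim S.left = 1 →
    (∀ s : ComplexPoints S, ∃ A' : AbelianVariety ℂ, A'.dim = n ∧ Nonempty (A'.X ≅ fiberOver f s)) →
    (∃ e : S ⟶ 𝒳, e ≫ f = 𝟙 S) →
    ∀ (p : ℕ) (W : complexBetti 𝒳 (2 * p)),
      (∀ s : ComplexPoints S, IsRationalClass (complexBetti.map (fiberι f s) (2 * p) W) ∧
        IsOfHodgeType n (fiberOver f s) (2 * p) p p (complexBetti.map (fiberι f s) (2 * p) W)) →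
      ∀ s₀ : ComplexPoints S,
        complexBetti.map (fiberι f s₀) (2 * p) W ∈ algebraicClasses (fiberOver f s₀) p →
        ∃ (s₁ : ComplexPoints S) (I : Finset ℕ) (κ : (q : ℕ) → complexBetti (fiberOver f s₁) (2 * q))
          (V : (q : ℕ) → complexBetti 𝒳 (2 * q)) (a : ℂ) (Z : complexBetti 𝒳 (2 * p)),
          p ∈ I ∧ 𝒪 n (fiberOver f s₁) I κ ∧ a ≠ 0 ∧
          (∀ s : ComplexPoints S,
            complexBetti.map (fiberι f s) (2 * p) Z ∈ algebraicClasses (fiberOver f s) p ∧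
            complexBetti.map (fiberι f s) (2 * p) Z ∈ divisorClassesSpan (fiberOver f s) n p) ∧
          V p = a • W + Z ∧
          (∀ q ∈ I, κ q = complexBetti.map (fiberι f s₁) (2 * q) (V q)) ∧
          (∀ q ∈ I, ∀ s : ComplexPoints S,
            IsOfHodgeType n (fiberOver f s) (2 * q) q q (complexBetti.map (fiberι f s) (2 * q) (V q)))

/-- **K-SR♭∃ `SemiregularSheafRepresentativesLefAt`** — the sheaf-door instance (RECOMMENDED crux, rank 2, of the
repaired b02 brief). [cite: BuchweitzFlenner2003, §5 Thm. 5.1 and Def. 4.10] [cite: Bloch1972Semiregularity, Remark (7.5)] -/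
@[conjecture] def SemiregularSheafRepresentativesLefAt : Prop :=
  ∀ C : ChernCharacterBetti, AdmissibleRepresentativesLefAt (bfSheafClass C)

/-- K-SR♭ ⟹ K-SR♭∃ (take `s₁ := s₀`). [folklore] -/
theorem AdmissibleRepresentativesLef.toLefAt {𝒪 : ObjClass} (h : AdmissibleRepresentativesLef 𝒪) :
    AdmissibleRepresentativesLefAt 𝒪 := by
  intro n 𝒳 S f hf h𝒳 hirr haff hsm hdim habel he p W hW s₀ hs₀
  obtain ⟨I, κ, V, a, Z, hpI, hκ, ha, hZ, hVp, hκV, hVH⟩ := h f hf h𝒳 hirr haff hsm hdim habel he p W hW s₀ hs₀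
  exact ⟨s₀, I, κ, V, a, Z, hpI, hκ, ha, hZ, hVp, hκV, hVH⟩

/-- K-SR♭ ⟹ K-SR♭∃ for the sheaf door (take `s₁ := s₀`), door by door. [folklore] -/
theorem semiregularSheafRepresentativesLefAt_of_lef (h : SemiregularSheafRepresentativesLef) :
    SemiregularSheafRepresentativesLefAt :=
  fun C => (h C).toLefAt

/-- Monotonicity of K-SR♭∃ in the door. [folklore] -/
theorem AdmissibleRepresentativesLefAt.mono {𝒪 𝒪' : ObjClass} (h𝒪 : ∀ n X₀ I κ, 𝒪 n X₀ I κ → 𝒪' n X₀ I κ)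
    (h : AdmissibleRepresentativesLefAt 𝒪) : AdmissibleRepresentativesLefAt 𝒪' := by
  intro n 𝒳 S f hf h𝒳 hirr haff hsm hdim habel he p W hW s₀ hs₀
  obtain ⟨s₁, I, κ, V, a, Z, hpI, hκ, ha, hZ, hVp, hκV, hVH⟩ := h f hf h𝒳 hirr haff hsm hdim habel he p W hW s₀ hs₀
  exact ⟨s₁, I, κ, V, a, Z, hpI, h𝒪 _ _ _ _ hκ, ha, hZ, hVp, hκV, hVH⟩

/-- Functoriality bookkeeping (`(Iso.refl X).inv^* = id`). [folklore] -/
private theorem map_refl_inv' (X : SchemeOver ℂ) (k : ℕ) (c : complexBetti X k) :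
    complexBetti.map (Iso.refl X).inv k c = c := by
  rw [Iso.refl_inv, complexBetti.map_id]
  rfl

/-- **Door + K-SR♭∃ ⟹ ring 2's node (U)**: the door at the model `Iso.refl 𝒳_{s₁}` (its Hodge hypothesis holds
because the transport of `κ_q = V_q|_{s₁}` along any path is `V_q|_t`, `transportFun_map_fiberι`) makes the transport
of `κ_p`, i.e. `a·W|_t + Z|_t`, algebraic on the path component of `s₁` in the door's open set; `Z|_t` is algebraic,
so `W|_t` is, on an open set containing `s₁` — uncountable on a smooth irreducible curve
(`not_countable_of_isOpen_of_curve`). The landed germ proof `oneParameterAbelianSchemeVHCGerm_of` VERBATIM with the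
anchor moved from `s₀` to `s₁`. [cite: BuchweitzFlenner2003, §5 Thm. 5.1 (argument shape)]
[cite: VoisinHodgeI2002, §9.2.1 and Thm. 9.3] [cite: SerreGAGA1956, §2 n°5 Prop. 2 and n°6] -/
theorem oneParameterAbelianSchemeVHCUncountable_of_lefAt {𝒪 : ObjClass} (hT : LocalVariationalHodgeFor 𝒪)
    (hSR : AdmissibleRepresentativesLefAt 𝒪) : OneParameterAbelianSchemeVHCUncountable := by
  intro n 𝒳 S f hf h𝒳 hirr haff hsm hdim habel he p W hW s₀ hs₀
  haveI := hirr
  haveI := hsm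
  haveI : LocallyOfFiniteType S.hom := inferInstance
  haveI : LocallyPathConnectedSpace (ComplexPoints S) := locallyPathConnectedSpace_complexPoints_of_smooth S
  have hU : IsCohomologicallyLocallyTrivialOn f (Set.univ : Set (ComplexPoints S)) :=
    isCohomologicallyLocallyTrivialOn_univ_of_isSmoothProjectiveFamily_of_smooth f hf
  obtain ⟨s₁, I, κ, V, a, Z, hpI, hκ, ha, hZ, hVp, hκV, hVH⟩ :=
    hSR f hf h𝒳 hirr haff hsm hdim habel he p W hW s₀ hs₀
  let s₁' : (Set.univ : Set (ComplexPoints S)) := ⟨s₁, Set.mem_univ s₁⟩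
  have hHodge : ∀ q ∈ I, ∀ (t : (Set.univ : Set (ComplexPoints S))) (γ : Path.Homotopic.Quotient s₁' t),
      IsOfHodgeType n (fiberOver f t.1) (2 * q) q q
        (transportFun f (2 * q) hU γ (complexBetti.map (Iso.refl (fiberOver f s₁)).inv (2 * q) (κ q))) := by
    intro q hq t γ
    rw [map_refl_inv', hκV q hq, transportFun_map_fiberι f (2 * q) hU γ (V q)]
    exact hVH q hq t.1
  obtain ⟨W', hWo, hW'₁, hWU, hW'⟩ := hT f n hf hsm hU s₁' (fiberOver f s₁) (Iso.refl _) I κ hκ hHodge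
  -- `W` is algebraic on the path component of `s₁` in `W'`
  have halg : ∀ t ∈ pathComponentIn W' s₁,
      complexBetti.map (fiberι f t) (2 * p) W ∈ algebraicClasses (fiberOver f t) p := by
    intro t ht
    have hj : JoinedIn W' s₁ t := ht
    have hpm : ∀ u, hj.somePath u ∈ W' := hj.somePath_mem
    let γ : Path (⟨s₁, hW'₁⟩ : W') ⟨t, pathComponentIn_subset ht⟩ :=
      { toFun := fun u ↦ ⟨hj.somePath u, hpm u⟩
        continuous_toFun := hj.somePath.continuous.subtype_mk _
        source' := Subtype.ext hj.somePath.source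
        target' := Subtype.ext hj.somePath.target }
    have hmem := hW' p hpI ⟨t, pathComponentIn_subset ht⟩ ⟦γ⟧
    have htr : transportFun f (2 * p) (hU.mono hWU hWo) ⟦γ⟧
        (complexBetti.map (Iso.refl (fiberOver f s₁)).inv (2 * p) (κ p)) =
        a • complexBetti.map (fiberι f t) (2 * p) W + complexBetti.map (fiberι f t) (2 * p) Z := by
      rw [map_refl_inv', hκV p hpI, transportFun_map_fiberι f (2 * p) (hU.mono hWU hWo) ⟦γ⟧ (V p), hVp,
        map_add, map_smul]
    change transportFun f (2 * p) (hU.mono hWU hWo) ⟦γ⟧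
        (complexBetti.map (Iso.refl (fiberOver f s₁)).inv (2 * p) (κ p)) ∈ _ at hmem
    rw [htr] at hmem
    have hWt : complexBetti.map (fiberι f t) (2 * p) W =
        a⁻¹ • ((a • complexBetti.map (fiberι f t) (2 * p) W + complexBetti.map (fiberι f t) (2 * p) Z) -
          complexBetti.map (fiberι f t) (2 * p) Z) := by
      rw [add_sub_cancel_right, smul_smul, inv_mul_cancel₀ ha, one_smul]
    rw [hWt]
    exact Submodule.smul_mem _ _ (Submodule.sub_mem _ hmem (hZ t).1)
  intro hc
  exact not_countable_of_isOpen_of_curve hdim (hWo.pathComponentIn s₁) ⟨s₁, mem_pathComponentIn_self hW'₁⟩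
    (hc.mono fun t ht => halg t ht)

/-- **Door + K-SR♭∃ + the curve residual ⟹ row b02** (ring 2's exactness through node (U)).
[cite: CharlesSchnell2014Notes, Conj. 11.3.1 and Prop. 11.3.11 (proof)] [cite: GortzWedhorn2023, Thm. 27.291] -/
theorem abelianSchemeVHC_of_lefAt {𝒪 : ObjClass} (hT : LocalVariationalHodgeFor 𝒪)
    (hSR : AdmissibleRepresentativesLefAt 𝒪) (hqp : OneParameterAbelianSchemeQuasiProjective) : AbelianSchemeVHC :=
  abelianSchemeVHC_of_uncountable_of_oneParameterAbelianSchemeQuasiProjective hqp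
    (oneParameterAbelianSchemeVHCUncountable_of_lefAt hT hSR)

/-- **Door + K-SR♭∃ + curve residual + André 1996 ⟹ `HC_AV`** (no `HC_CM`, no anchored-family leaf).
[cite: Andre1996Motifs, §6.3 Lemmes 6.3.1–6.3.3 and Remarque 2 (p. 33)] -/
theorem hc_av_of_lefAt {𝒪 : ObjClass} (hT : LocalVariationalHodgeFor 𝒪) (hSR : AdmissibleRepresentativesLefAt 𝒪)
    (hqp : OneParameterAbelianSchemeQuasiProjective) (h₂₁ : andre1996_cmAnchoredPencil)
    (h₂₂ : andre1996_cmHodgeClasses_algebraicallyAnchoredPencils) :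
    Theses.PadicSemiregularLift.HodgeAbelianVarieties :=
  (Ring2.Deform.HC_AV_iff_abelianSchemeVHC_of_andre1996 h₂₁ h₂₂).mpr (abelianSchemeVHC_of_lefAt hT hSR hqp)

/-- **The RECOMMENDED `closes`-shape of the repaired b02 route**:
`K-C → K-SR♭∃ → BF Thm. 5.1 (tree fact) → curve residual → André #21 → André #22 → HC_AV`.
[cite: BuchweitzFlenner2003, §5 Thm. 5.1] [cite: Andre1996Motifs, §6.3 Lemmes 6.3.1–6.3.3] -/
theorem hc_av_of_semiregularSheafRepresentativesLefAt (hC : ChernCharacterOnBetti)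
    (hSR : SemiregularSheafRepresentativesLefAt)
    (hBF : BuchweitzFlenner2003_variationalHodge_ISemiregular_model)
    (hqp : OneParameterAbelianSchemeQuasiProjective) (h₂₁ : andre1996_cmAnchoredPencil)
    (h₂₂ : andre1996_cmHodgeClasses_algebraicallyAnchoredPencils) :
    Theses.PadicSemiregularLift.HodgeAbelianVarieties := by
  obtain ⟨C⟩ := hC
  exact hc_av_of_lefAt (localVariationalHodgeFor_bfSheafClass hBF C) (hSR C) hqp h₂₁ h₂₂

/-- The same onto row b02. [cite: BuchweitzFlenner2003, §5 Thm. 5.1] -/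
theorem abelianSchemeVHC_of_semiregularSheafRepresentativesLefAt (hC : ChernCharacterOnBetti)
    (hSR : SemiregularSheafRepresentativesLefAt)
    (hBF : BuchweitzFlenner2003_variationalHodge_ISemiregular_model)
    (hqp : OneParameterAbelianSchemeQuasiProjective) : AbelianSchemeVHC := by
  obtain ⟨C⟩ := hC
  exact abelianSchemeVHC_of_lefAt (localVariationalHodgeFor_bfSheafClass hBF C) (hSR C) hqp


/-! ## §5 Director check (a) in the kernel: the g7 null / Lefschetz instantiation FAILS against K-SR♭ at an exceptional class

At the level of ONE fibre `X₀` the K-SR♭ / K-SR♭∃ condition on the chosen fibre reads: `κ_p = a·w + z` with `a ≠ 0` and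
`z ∈ Dᵖ(X₀) ⊗ ℂ`. If the carrier is LEFSCHETZ (`κ_p ∈ Dᵖ ⊗ ℂ`: the null carrier `ℰ₀ = 0`, `𝒪_X`, line bundles,
their sums, semi-homogeneous bundles) this forces `w ∈ Dᵖ ⊗ ℂ`. Weil 1977 / van Geemen Thm. 4.11
(`Weil1977_exceptionalHodgeClasses`, barrier fact) supplies an abelian fourfold with a rational `(2,2)`-class OUTSIDE
`D² ⊗ ℂ`: there NO Lefschetz datum exists — the g7 witness `(I, κ, V, a, Z) := ({p}, 0, 0, 1, −W)` that discharged K-SR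
is dead against K-SR♭, and so is every divisor-polynomial carrier. -/

/-- **No Lefschetz datum at an exceptional class** (fibre level). [cite: vanGeemen1994HodgeAV, §2.4–2.5 and Thm. 4.11] -/
theorem no_lefschetzDatum_of_exceptional {X₀ : SchemeOver ℂ} {N p : ℕ} {w : complexBetti X₀ (2 * p)}
    (hw : w ∉ divisorClassesSpan X₀ N p) :
    ¬ ∃ (κ z : complexBetti X₀ (2 * p)) (a : ℂ), a ≠ 0 ∧ κ ∈ divisorClassesSpan X₀ N p ∧
      z ∈ divisorClassesSpan X₀ N p ∧ κ = a • w + z := by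
  rintro ⟨κ, z, a, ha, hκ, hz, hκw⟩
  apply hw
  have hw' : w = a⁻¹ • (κ - z) := by
    rw [hκw, add_sub_cancel_right, smul_smul, inv_mul_cancel₀ ha, one_smul]
  rw [hw']
  exact Submodule.smul_mem _ _ (Submodule.sub_mem _ hκ hz)

/-- **The g7 NULL datum (`κ_p = 0`, i.e. `ℰ₀ = 0`) fails at an exceptional class.** [cite: vanGeemen1994HodgeAV, Thm. 4.11] -/
theorem nullDatum_fails_of_exceptional {X₀ : SchemeOver ℂ} {N p : ℕ} {w : complexBetti X₀ (2 * p)}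
    (hw : w ∉ divisorClassesSpan X₀ N p) :
    ¬ ∃ (z : complexBetti X₀ (2 * p)) (a : ℂ), a ≠ 0 ∧ z ∈ divisorClassesSpan X₀ N p ∧
      (0 : complexBetti X₀ (2 * p)) = a • w + z := by
  rintro ⟨z, a, ha, hz, h0⟩
  exact no_lefschetzDatum_of_exceptional hw ⟨0, z, a, ha, Submodule.zero_mem _, hz, h0⟩

/-- **Weil's exceptional fourfold defeats every Lefschetz carrier** — the barrier fact instantiated: an abelian FOURFOLD
`A` and a rational `(2,2)`-class `c` on it for which NO datum `(κ, z, a)` with `κ, z ∈ D²(A) ⊗ ℂ`, `a ≠ 0`,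
`κ = a·c + z` exists. So K-SR♭ / K-SR♭∃ at such a fibre demand a carrier with EXCEPTIONAL `ch₂` — the typed residue of
road b02 beyond «codimension 1 / divisor polynomials». [cite: vanGeemen1994HodgeAV, Thm. 4.11] [cite: Weil1977HodgeRing] -/
theorem weilFourfold_defeats_lefschetzCarriers (h : Weil1977_exceptionalHodgeClasses) :
    ∃ (A : AbelianVariety ℂ) (c : complexBetti A.X (2 * 2)), A.dim = 2 * 2 ∧ IsRationalClass c ∧
      IsOfHodgeType (2 * 2) A.X (2 * 2) 2 2 c ∧
      ¬ ∃ (κ z : complexBetti A.X (2 * 2)) (a : ℂ), a ≠ 0 ∧ κ ∈ divisorClassesSpan A.X (2 * 2) 2 ∧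
        z ∈ divisorClassesSpan A.X (2 * 2) 2 ∧ κ = a • c + z := by
  obtain ⟨A, hd, -, c, hc, hcH, hexc⟩ := h 2 le_rfl
  exact ⟨A, c, hd, hc, hcH, no_lefschetzDatum_of_exceptional hexc⟩

end Summit.HodgeConjecture.HodgeConjecture.Ring2.SemiregularRepresentatives

end
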